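import Summits.Parity.GeneralizedHardyLittlewood.Theorems.BeyondDiagonalBeatsQuarter.OffDiagBoxes
import HarnessLib

/-!
# Route `PrimeLevelFamEdge`, crux K_B (stmt-Parity-20343), line `diagonal_kernel_split` rev 4, plan Ω,
# worker key W-b (ii), part 2 `OffDiagBoxesNearFar`: the FAR boxes of a Kloosterman layer in total, and the
# NEAR/FAR split `Σ_k s(k) = Σ_{i ∈ nearBoxes} box_i + Σ_i 𝟙[FAR i]·box_i` with a FINITE near set

Continues `OffDiagBoxes.lean` (per-box bounds `norm_boxSum_le_near/_far`). For one layer piece `(d₁,d₂,r)` of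
`offDiag q l m` (`s(k) = w_q(d₁k₁,d₂k₂)·petKloostermanTerm q ((l/d₁)k₁)((m/d₂)k₂) r`, boxes
`box_i = Σ_k θ(k₁/2^{i₁})θ(k₂/2^{i₂})·s(k)`, FAR `i` iff `4q̂²y₀ ≤ 2^{i₁+i₂}d₁d₂`):
* **`norm_tsum_farBoxes_le`**: `‖Σ_{i} 𝟙[FAR i]·box_i‖ ≤ 6144·(Σ_jρ^j)²·e^{−√y₀/2}·q̂³(lm)^{3/4}(d₁d₂)^{−5/4}·
  4πC q^{−1/2}r^{−29/20}` (`ρ = 2^{−1/4}`; geometric in the box index);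
* `nearBoxes q d₁ d₂ y₀` — the finite set `{i : 2^{i₁+i₂}d₁d₂ < 4q̂²y₀}` (inside `[0,⌈4q̂²y₀⌉)²`),
  `mem_nearBoxes_of_not_far`;
* `summable_layerSummand` (Ω-d3's `summable_ite_piece` transported along `k ↦ (d₁k₁,d₂k₂)`) and
  **`tsum_layerSummand_eq_near_add_far`**: `Σ_k s(k) = Σ_{i ∈ nearBoxes} box_i + Σ_i 𝟙[FAR i]·box_i`.
With `y₀ = (log q)⁴` the far part is `O(e^{−(log q)²/2}·poly(q))`, negligible against `mainScaleReal`
(assembled in `OffDiagTailsMollifiedBoxes.lean`); the near boxes are what Ω-d5's `tsum_box_eq_tsum_dual` dualises.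
Absolute-value bookkeeping only; nothing about the heart. Helper (`--supports stmt-Parity-20343`); standard axioms.
«The programme SEARCHES and TYPES; no claim about Landau–Siegel zeros, Theorems 1–2 of arXiv:2211.02515 or
a repaired Margin232 until a kernel theorem says so.»
-/


noncomputable section

open Finset
open scoped Real Nat

namespace Summit.Parity.GeneralizedHardyLittlewood.Theorems.BeyondDiagonalBeatsQuarter.PeterssonSplit

open Literature.NumberTheory.LFunctions Literature.NumberTheory.LFunctions.KMV2000
open Literature.NumberTheory.LFunctions.KowalskiMichel2000 (petKloostermanTerm)
open Literature.Analysis.Calculus.WhitneyConvex (dyadicBump dyadicBump_nonneg dyadicBump_le_one)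
open Summit.Parity.GeneralizedHardyLittlewood.Theorems.PrimeLevelFamEdgeIdeaDeltas.PeterssonLayers
  (cutoffW_le_exp_mul_rpow summable_prod_rpow)
open Summit.Parity.GeneralizedHardyLittlewood.Theorems.BeyondDiagonalBeatsQuarter.OffDiag
  (mem_Ioo_of_dyadicBump_div_two_pow_ne_zero dyadicWeight_mem_Icc tsum_dyadicBox_eq_sum
    tsum_eq_tsum_dyadicBoxes summable_dyadicBoxes afeWeight_dilated_eq_zero_of_axis)

variable {q : ℕ} [NeZero q]

/-! ### §1. The far boxes in total, and the near/far split of a layer piece -/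

omit [NeZero q] in
/-- The geometric weights `ρ^{i₁}ρ^{i₂}`, `ρ = 2^{−1/4} < 1`, are summable on `ℕ²`, with sum `(Σ_i ρ^i)²`.
[folklore] -/
theorem hasSum_rho_pow_prod :
    HasSum (fun i : ℕ × ℕ ↦ ((2 : ℝ) ^ (-(1 / 4 : ℝ))) ^ i.1 * ((2 : ℝ) ^ (-(1 / 4 : ℝ))) ^ i.2)
      ((∑' j : ℕ, ((2 : ℝ) ^ (-(1 / 4 : ℝ))) ^ j) ^ 2) := by
  have hρ0 : 0 ≤ (2 : ℝ) ^ (-(1 / 4 : ℝ)) := by positivity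
  have hρ1 : (2 : ℝ) ^ (-(1 / 4 : ℝ)) < 1 :=
    Real.rpow_lt_one_of_one_lt_of_neg (by norm_num) (by norm_num)
  have hg := summable_geometric_of_lt_one hρ0 hρ1
  have h := hg.hasSum.mul hg.hasSum (hg.mul_of_nonneg hg (fun _ ↦ by positivity) (fun _ ↦ by positivity))
  rwa [← sq] at h

/-- **The far boxes of one layer piece are exponentially small in `√y₀`.** For `q` prime, `l, m ≥ 1`,
`d₁ ∣ l`, `d₂ ∣ m`, `τ(r) ≤ C r^{1/20}`, `y₀ > 0` and every `r`:
`‖Σ_{i ∈ ℕ²} 𝟙[4q̂²y₀ ≤ 2^{i₁+i₂}d₁d₂]·box_i‖ ≤ 6144·(Σ_jρ^j)²·e^{−√y₀/2}·q̂³(lm)^{3/4}(d₁d₂)^{−5/4}·4πC q^{−1/2}r^{−29/20}`.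
[cite: KowalskiMichel2000, §2.4.2 p. 312 (23); KowalskiMichelVanderKam2000, (22) p. 12 — derivation] -/
theorem norm_tsum_farBoxes_le (hq : q.Prime) {l m : ℕ} (hl : 1 ≤ l) (hm : 1 ≤ m) {d₁ d₂ : ℕ}
    (hd₁ : d₁ ∈ l.divisors) (hd₂ : d₂ ∈ m.divisors) {C : ℝ}
    (hC : ∀ r : ℕ, ((r.divisors.card : ℕ) : ℝ) ≤ C * (r : ℝ) ^ (1 / 20 : ℝ)) (r : ℕ) {y₀ : ℝ} (hy₀ : 0 < y₀) :
    Summable (fun i : ℕ × ℕ ↦ if 4 * qhat q ^ 2 * y₀ ≤ 2 ^ (i.1 + i.2) * ((d₁ : ℝ) * d₂) then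
      ∑' k : ℕ × ℕ, ((dyadicBump ((k.1 : ℝ) / 2 ^ i.1) * dyadicBump ((k.2 : ℝ) / 2 ^ i.2) : ℝ) : ℂ) *
        ((afeWeight q (d₁ * k.1, d₂ * k.2) : ℂ) * petKloostermanTerm q (l / d₁ * k.1) (m / d₂ * k.2) r)
      else 0) ∧
    ‖∑' i : ℕ × ℕ, (if 4 * qhat q ^ 2 * y₀ ≤ 2 ^ (i.1 + i.2) * ((d₁ : ℝ) * d₂) then
      ∑' k : ℕ × ℕ, ((dyadicBump ((k.1 : ℝ) / 2 ^ i.1) * dyadicBump ((k.2 : ℝ) / 2 ^ i.2) : ℝ) : ℂ) *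
        ((afeWeight q (d₁ * k.1, d₂ * k.2) : ℂ) * petKloostermanTerm q (l / d₁ * k.1) (m / d₂ * k.2) r)
      else 0)‖ ≤
      6144 * (∑' j : ℕ, ((2 : ℝ) ^ (-(1 / 4 : ℝ))) ^ j) ^ 2 * Real.exp (-(Real.sqrt y₀ / 2)) * qhat q ^ 3 *
        ((l : ℝ) * m) ^ (3 / 4 : ℝ) * (((d₁ : ℝ) * d₂) ^ (-(5 / 4 : ℝ))) *
        (4 * π * C * (q : ℝ) ^ (-(1 / 2 : ℝ)) * (r : ℝ) ^ (-(29 / 20 : ℝ))) := by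
  have hq1 : 1 ≤ q := hq.one_lt.le
  have hQ : 0 < qhat q := qhat_pos hq1
  have hC0 : 0 ≤ C := by
    have h := hC 1
    simp at h
    linarith
  have hd₁0 : (0 : ℝ) < d₁ := by exact_mod_cast Nat.pos_of_mem_divisors hd₁
  have hd₂0 : (0 : ℝ) < d₂ := by exact_mod_cast Nat.pos_of_mem_divisors hd₂
  set A : ℝ := 64 * ((l : ℝ) * m) ^ (3 / 4 : ℝ) * (4 * π * C * (q : ℝ) ^ (-(1 / 2 : ℝ)) * (r : ℝ) ^ (-(29 / 20 : ℝ))) *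
    (96 * Real.exp (-(Real.sqrt y₀ / 2)) * qhat q ^ 3) * (((d₁ : ℝ) * d₂) ^ (-(5 / 4 : ℝ))) with hA
  have hA0 : 0 ≤ A := by positivity
  have hG := hasSum_rho_pow_prod
  have hmaj : Summable (fun i : ℕ × ℕ ↦ A * (((2 : ℝ) ^ (-(1 / 4 : ℝ))) ^ i.1 * ((2 : ℝ) ^ (-(1 / 4 : ℝ))) ^ i.2)) :=
    hG.summable.mul_left A
  have hterm : ∀ i : ℕ × ℕ, ‖(if 4 * qhat q ^ 2 * y₀ ≤ 2 ^ (i.1 + i.2) * ((d₁ : ℝ) * d₂) then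
      ∑' k : ℕ × ℕ, ((dyadicBump ((k.1 : ℝ) / 2 ^ i.1) * dyadicBump ((k.2 : ℝ) / 2 ^ i.2) : ℝ) : ℂ) *
        ((afeWeight q (d₁ * k.1, d₂ * k.2) : ℂ) * petKloostermanTerm q (l / d₁ * k.1) (m / d₂ * k.2) r)
      else 0)‖ ≤ A * (((2 : ℝ) ^ (-(1 / 4 : ℝ))) ^ i.1 * ((2 : ℝ) ^ (-(1 / 4 : ℝ))) ^ i.2) := by
    intro i
    split_ifs with hfar
    · exact norm_boxSum_le_far hq hl hm hd₁ hd₂ hC r i hy₀ hfar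
    · rw [norm_zero]; positivity
  have hs : Summable (fun i : ℕ × ℕ ↦ if 4 * qhat q ^ 2 * y₀ ≤ 2 ^ (i.1 + i.2) * ((d₁ : ℝ) * d₂) then
      ∑' k : ℕ × ℕ, ((dyadicBump ((k.1 : ℝ) / 2 ^ i.1) * dyadicBump ((k.2 : ℝ) / 2 ^ i.2) : ℝ) : ℂ) *
        ((afeWeight q (d₁ * k.1, d₂ * k.2) : ℂ) * petKloostermanTerm q (l / d₁ * k.1) (m / d₂ * k.2) r)
      else 0) := Summable.of_norm_bounded hmaj hterm
  refine ⟨hs, ?_⟩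
  calc _ ≤ ∑' i : ℕ × ℕ, A * (((2 : ℝ) ^ (-(1 / 4 : ℝ))) ^ i.1 * ((2 : ℝ) ^ (-(1 / 4 : ℝ))) ^ i.2) :=
        tsum_of_norm_bounded hmaj.hasSum hterm
    _ = A * (∑' j : ℕ, ((2 : ℝ) ^ (-(1 / 4 : ℝ))) ^ j) ^ 2 := by rw [tsum_mul_left, hG.tsum_eq]
    _ = _ := by rw [hA]; ring

/-- **The finite set of NEAR boxes** of the layer piece `(d₁,d₂)` at threshold `y₀`:
`nearBoxes q d₁ d₂ y₀ = {i : 2^{i₁+i₂}·d₁d₂ < 4q̂²y₀}` (realised inside `[0, ⌈4q̂²y₀⌉)²`; for `d₁d₂ ≥ 1` it contains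
every non-far box, `mem_nearBoxes_of_not_far`). A bookkeeping abbreviation of this line.
[cite: KowalskiMichelVanderKam2000, Lemma 3.3 p. 9 — derivation] -/
def nearBoxes (q d₁ d₂ : ℕ) (y₀ : ℝ) : Finset (ℕ × ℕ) :=
  (Finset.range ⌈4 * qhat q ^ 2 * y₀⌉₊ ×ˢ Finset.range ⌈4 * qhat q ^ 2 * y₀⌉₊).filter
    (fun i : ℕ × ℕ ↦ ¬ (4 * qhat q ^ 2 * y₀ ≤ 2 ^ (i.1 + i.2) * ((d₁ : ℝ) * d₂)))

omit [NeZero q] in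
/-- Members of `nearBoxes` are not far. [folklore] -/
theorem not_far_of_mem_nearBoxes {d₁ d₂ : ℕ} {y₀ : ℝ} {i : ℕ × ℕ} (hi : i ∈ nearBoxes q d₁ d₂ y₀) :
    ¬ (4 * qhat q ^ 2 * y₀ ≤ 2 ^ (i.1 + i.2) * ((d₁ : ℝ) * d₂)) :=
  (Finset.mem_filter.1 hi).2

omit [NeZero q] in
/-- **Every non-far box is near** (`d₁d₂ ≥ 1`): `2^{i₁+i₂}d₁d₂ < 4q̂²y₀` forces `i₁, i₂ < ⌈4q̂²y₀⌉`.
[folklore] -/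
theorem mem_nearBoxes_of_not_far {d₁ d₂ : ℕ} (hd : 1 ≤ d₁ * d₂) {y₀ : ℝ} {i : ℕ × ℕ}
    (hi : ¬ (4 * qhat q ^ 2 * y₀ ≤ 2 ^ (i.1 + i.2) * ((d₁ : ℝ) * d₂))) :
    i ∈ nearBoxes q d₁ d₂ y₀ := by
  rw [nearBoxes, Finset.mem_filter, Finset.mem_product, Finset.mem_range, Finset.mem_range]
  refine ⟨⟨?_, ?_⟩, hi⟩
  all_goals
    rw [not_le] at hi
    have hd' : (1 : ℝ) ≤ (d₁ : ℝ) * d₂ := by exact_mod_cast hd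
    have hT : (2 : ℝ) ^ (i.1 + i.2) < 4 * qhat q ^ 2 * y₀ :=
      lt_of_le_of_lt (le_mul_of_one_le_right (by positivity) hd') hi
    refine Nat.lt_ceil.2 (lt_of_lt_of_le ?_ hT.le)
  · calc (i.1 : ℝ) < 2 ^ i.1 := by exact_mod_cast Nat.lt_two_pow_self
      _ ≤ 2 ^ (i.1 + i.2) := pow_le_pow_right₀ (by norm_num) (Nat.le_add_right _ _)
  · calc (i.2 : ℝ) < 2 ^ i.2 := by exact_mod_cast Nat.lt_two_pow_self
      _ ≤ 2 ^ (i.1 + i.2) := pow_le_pow_right₀ (by norm_num) (Nat.le_add_left _ _)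

/-- The re-indexed layer summand is absolutely summable on `ℕ²` (Ω-d3's `summable_ite_piece`, transported
along `k ↦ (d₁k₁, d₂k₂)`). [cite: KowalskiMichel2000, §2.4.2 p. 312 (23) — derivation] -/
theorem summable_layerSummand (hq : q.Prime) {l m : ℕ} (hl : 1 ≤ l) (hm : 1 ≤ m) {d₁ d₂ : ℕ}
    (hd₁ : d₁ ∈ l.divisors) (hd₂ : d₂ ∈ m.divisors) (r : ℕ) :
    Summable (fun k : ℕ × ℕ ↦
      (afeWeight q (d₁ * k.1, d₂ * k.2) : ℂ) * petKloostermanTerm q (l / d₁ * k.1) (m / d₂ * k.2) r) := by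
  have hd₁0 : d₁ ≠ 0 := (Nat.pos_of_mem_divisors hd₁).ne'
  have hd₂0 : d₂ ≠ 0 := (Nat.pos_of_mem_divisors hd₂).ne'
  have hp : (d₁, d₂) ∈ l.divisors ×ˢ m.divisors := Finset.mem_product.2 ⟨hd₁, hd₂⟩
  have hg : Function.Injective (fun k : ℕ × ℕ ↦ (d₁ * k.1, d₂ * k.2)) := by
    intro s t hst
    simp only [Prod.mk.injEq] at hst
    exact Prod.ext (Nat.eq_of_mul_eq_mul_left (Nat.pos_of_ne_zero hd₁0) hst.1)
      (Nat.eq_of_mul_eq_mul_left (Nat.pos_of_ne_zero hd₂0) hst.2)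
  have h := (summable_ite_piece hq hl hm hp r).comp_injective hg
  refine h.congr fun k ↦ ?_
  simp only [Function.comp_apply]
  rw [if_pos ⟨Dvd.intro _ rfl, Dvd.intro _ rfl⟩, mul_mul_div_sq (Nat.dvd_of_mem_divisors hd₁) hd₁0,
    mul_mul_div_sq (Nat.dvd_of_mem_divisors hd₂) hd₂0]

/-- **The near/far split of one layer piece.** For `q` prime, `l, m ≥ 1`, `d₁ ∣ l`, `d₂ ∣ m`, `y₀`, `r`:
`Σ_k w_q(d₁k₁,d₂k₂)·petKloostermanTerm q ((l/d₁)k₁)((m/d₂)k₂) r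
   = Σ_{i ∈ nearBoxes q d₁ d₂ y₀} box_i + Σ_{i ∈ ℕ²} 𝟙[4q̂²y₀ ≤ 2^{i₁+i₂}d₁d₂]·box_i`
(Ω-d4's dyadic partition, then the boxes sorted by the threshold; the near sum is FINITE).
[cite: KowalskiMichelVanderKam2000, (21)–(23) p. 12 and Lemma 3.3 p. 9 — derivation] -/
theorem tsum_layerSummand_eq_near_add_far (hq : q.Prime) {l m : ℕ} (hl : 1 ≤ l) (hm : 1 ≤ m) {d₁ d₂ : ℕ}
    (hd₁ : d₁ ∈ l.divisors) (hd₂ : d₂ ∈ m.divisors) (y₀ : ℝ) (r : ℕ) :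
    ∑' k : ℕ × ℕ, (afeWeight q (d₁ * k.1, d₂ * k.2) : ℂ) * petKloostermanTerm q (l / d₁ * k.1) (m / d₂ * k.2) r =
      ∑ i ∈ nearBoxes q d₁ d₂ y₀, ∑' k : ℕ × ℕ,
          ((dyadicBump ((k.1 : ℝ) / 2 ^ i.1) * dyadicBump ((k.2 : ℝ) / 2 ^ i.2) : ℝ) : ℂ) *
            ((afeWeight q (d₁ * k.1, d₂ * k.2) : ℂ) * petKloostermanTerm q (l / d₁ * k.1) (m / d₂ * k.2) r) +
        ∑' i : ℕ × ℕ, (if 4 * qhat q ^ 2 * y₀ ≤ 2 ^ (i.1 + i.2) * ((d₁ : ℝ) * d₂) then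
          ∑' k : ℕ × ℕ, ((dyadicBump ((k.1 : ℝ) / 2 ^ i.1) * dyadicBump ((k.2 : ℝ) / 2 ^ i.2) : ℝ) : ℂ) *
            ((afeWeight q (d₁ * k.1, d₂ * k.2) : ℂ) * petKloostermanTerm q (l / d₁ * k.1) (m / d₂ * k.2) r)
          else 0) := by
  have hd : 1 ≤ d₁ * d₂ := Nat.mul_pos (Nat.pos_of_mem_divisors hd₁) (Nat.pos_of_mem_divisors hd₂)
  have hsum := summable_layerSummand hq hl hm hd₁ hd₂ r
  -- the box series and its near / far indicator pieces
  set box : ℕ × ℕ → ℂ := fun i ↦ ∑' k : ℕ × ℕ,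
    ((dyadicBump ((k.1 : ℝ) / 2 ^ i.1) * dyadicBump ((k.2 : ℝ) / 2 ^ i.2) : ℝ) : ℂ) *
      ((afeWeight q (d₁ * k.1, d₂ * k.2) : ℂ) * petKloostermanTerm q (l / d₁ * k.1) (m / d₂ * k.2) r) with hbox
  have hboxes : Summable box := summable_dyadicBoxes hsum
  have hnear : Summable (fun i : ℕ × ℕ ↦
      if 4 * qhat q ^ 2 * y₀ ≤ 2 ^ (i.1 + i.2) * ((d₁ : ℝ) * d₂) then 0 else box i) := by
    refine Summable.of_norm_bounded hboxes.norm fun i ↦ ?_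
    split_ifs <;> simp
  have hfar : Summable (fun i : ℕ × ℕ ↦
      if 4 * qhat q ^ 2 * y₀ ≤ 2 ^ (i.1 + i.2) * ((d₁ : ℝ) * d₂) then box i else 0) := by
    refine Summable.of_norm_bounded hboxes.norm fun i ↦ ?_
    split_ifs <;> simp
  have hsplit : ∀ i : ℕ × ℕ, box i =
      (if 4 * qhat q ^ 2 * y₀ ≤ 2 ^ (i.1 + i.2) * ((d₁ : ℝ) * d₂) then 0 else box i) +
        (if 4 * qhat q ^ 2 * y₀ ≤ 2 ^ (i.1 + i.2) * ((d₁ : ℝ) * d₂) then box i else 0) := by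
    intro i; split_ifs <;> simp
  have hnear_eq : ∑' i : ℕ × ℕ, (if 4 * qhat q ^ 2 * y₀ ≤ 2 ^ (i.1 + i.2) * ((d₁ : ℝ) * d₂) then 0 else box i) =
      ∑ i ∈ nearBoxes q d₁ d₂ y₀, box i := by
    rw [tsum_eq_sum (s := nearBoxes q d₁ d₂ y₀) (fun i hi ↦ by
      by_cases h : 4 * qhat q ^ 2 * y₀ ≤ 2 ^ (i.1 + i.2) * ((d₁ : ℝ) * d₂)
      · rw [if_pos h]
      · exact absurd (mem_nearBoxes_of_not_far (q := q) hd h) hi)]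
    exact Finset.sum_congr rfl fun i hi ↦ by rw [if_neg (not_far_of_mem_nearBoxes hi)]
  rw [tsum_eq_tsum_dyadicBoxes hsum (fun k hk ↦ by
    rw [afeWeight_dilated_eq_zero_of_axis q d₁ d₂ hk, Complex.ofReal_zero, zero_mul])]
  change ∑' i : ℕ × ℕ, box i = ∑ i ∈ nearBoxes q d₁ d₂ y₀, box i +
    ∑' i : ℕ × ℕ, (if 4 * qhat q ^ 2 * y₀ ≤ 2 ^ (i.1 + i.2) * ((d₁ : ℝ) * d₂) then box i else 0)
  rw [tsum_congr hsplit, hnear.tsum_add hfar, hnear_eq]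

end Summit.Parity.GeneralizedHardyLittlewood.Theorems.BeyondDiagonalBeatsQuarter.PeterssonSplit
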